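import Literature.AnabelianGeometry.SemiGraphs.ArithBranchGeometricPart
import HarnessLib

/-!
# [SemiAnbd] Thm 3.7: commensurable edge-like subgroups of `π₁^temp(𝒢)` are equal

Mochizuki, *Semi-graphs of anabelioids*, Publ. RIMS **42** (2006), Thm 3.7 (iii)/(iv), pp. 40–41, and
§5, p. 65 (the branch decomposition groups `Π^temp_{𝔊,b}` of Thm 5.4 are cut out by COMMENSURATORS of
the geometric edge groups).  The edge-like twin of abc-iut-w4-d059's `verticial_commensurable_rigid`
(`TemperedVerticialCommensurable.lean`), i.e. the rigidity input «commensurable edge-like ⇒ equal» of the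
(AI3) edge dictionary of the arithmetic level data (row T54-0b, abc-iut-w4-d059), DISCHARGED modulo the one
named input `CompactInVerticial` (Thm 3.7 (iii), carried by abc-iut-L3-t11 — exactly as in
abc-iut-w4-d040's `commensurator_inf_eq_of_edgeLike_le_verticial`):

* `ProfiniteSemiGraph.inf_ne_bot_of_commensurable_of_mem_edgeLikeSubgroups` — commensurable edge-like
  subgroups meet nontrivially (edge-like subgroups are infinite);
* **`ProfiniteSemiGraph.eq_of_commensurable_of_mem_edgeLikeSubgroups`** — commensurable edge-like
  subgroups `L`, `L'` are EQUAL.  PROOF: `K := L ∩ L'` is compact and nontrivial, contained in the two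
  distinct verticial hosts `H₁ ≠ H₂` of `L` (abc-iut-w4-d040's `exists_two_hosts_of_mem_edgeLikeSubgroups`),
  so by the "precisely two" clause of `CompactInVerticial` every verticial subgroup containing `K` — in
  particular a host `H₃` of `L'` — is `H₁` or `H₂`; with a common verticial host `H`,
  `L = C(L) ∩ H = C(L') ∩ H = L'` (`commensurator_inf_eq_of_edgeLike_le_verticial` twice, and commensurable
  subgroups have the same commensurator);
* `ProfiniteSemiGraph.edgeLike_commensurable_rigid` — the same in the `VN`-binder shape of
  abc-iut-w4-d059's cores (`EN := {L | ∃ e, L ∈ edgeLikeSubgroups c e}`).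

No side is taken on [IUTchIII] Cor 3.12; typed ≠ proved. [cite: MochizukiSemiAnbd2006, Thm 3.7 (iii)(iv), pp. 40–41; §5, p. 65]
-/

namespace Literature.AnabelianGeometry.SemiGraphs

namespace ProfiniteSemiGraph

universe u

variable {𝒢 : ProfiniteSemiGraph.{u}}

/-- Commensurable edge-like subgroups meet nontrivially: `L ∩ L'` has finite index in the infinite group
`L`. [cite: MochizukiSemiAnbd2006, Cor. 3.9 p.42] -/
theorem inf_ne_bot_of_commensurable_of_mem_edgeLikeSubgroups (h𝒢 : 𝒢.Thm37Hypotheses)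
    (c : TemperedPiChart 𝒢) {e e' : 𝒢.graph.Edge} {L L' : Subgroup c.G}
    (hL : L ∈ edgeLikeSubgroups c e) (_hL' : L' ∈ edgeLikeSubgroups c e')
    (hc : Subgroup.Commensurable L L') : L ⊓ L' ≠ ⊥ := by
  intro hbot
  haveI := infinite_of_mem_edgeLikeSubgroups verticialInjective_holds h𝒢 c hL
  have h2 := hc.2
  rw [← Subgroup.inf_relIndex_left, hbot, Subgroup.relIndex_bot_left] at h2
  exact h2 Nat.card_eq_zero_of_infinite

/-- **Commensurable edge-like subgroups of `π₁^temp(𝒢)` are equal** (modulo `CompactInVerticial`,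
Thm 3.7 (iii)): the rigidity input of the (AI3) edge dictionary of [SemiAnbd] Thm 5.4's arithmetic level
data. [cite: MochizukiSemiAnbd2006, Thm 3.7 (iii)(iv), pp. 40–41] -/
theorem eq_of_commensurable_of_mem_edgeLikeSubgroups (hCV : CompactInVerticial.{u})
    (h𝒢 : 𝒢.Thm37Hypotheses) (hG : 𝒢.graph.IsGraph) (c : TemperedPiChart 𝒢) {e e' : 𝒢.graph.Edge}
    {L L' : Subgroup c.G} (hL : L ∈ edgeLikeSubgroups c e) (hL' : L' ∈ edgeLikeSubgroups c e')
    (hc : Subgroup.Commensurable L L') : L = L' := by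
  haveI := TemperedPiChart.t2Space c
  -- the compact nontrivial `K := L ∩ L'`
  have hKc : IsCompact ((L ⊓ L' : Subgroup c.G) : Set c.G) := by
    rw [Subgroup.coe_inf]
    exact (isCompact_of_mem_edgeLikeSubgroups c hL).inter_right
      (isCompact_of_mem_edgeLikeSubgroups c hL').isClosed
  have hKne : L ⊓ L' ≠ ⊥ := inf_ne_bot_of_commensurable_of_mem_edgeLikeSubgroups h𝒢 c hL hL' hc
  -- branches presenting the two edges
  obtain ⟨b, -, -, hbe, -, -⟩ := 𝒢.graph.two_branches e
  obtain ⟨b', -, -, hb'e, -, -⟩ := 𝒢.graph.two_branches e'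
  have hLb : L ∈ edgeLikeSubgroups c (𝒢.graph.edgeOf b) := by rw [hbe]; exact hL
  have hL'b : L' ∈ edgeLikeSubgroups c (𝒢.graph.edgeOf b') := by rw [hb'e]; exact hL'
  -- the two hosts of `L`, and one host of `L'`
  obtain ⟨u₁, u₂, H₁, H₂, hH₁, hH₂, h12, hLH₁, hLH₂⟩ :=
    exists_two_hosts_of_mem_edgeLikeSubgroups_of_isGraph h𝒢 hG c b hLb
  obtain ⟨u₃, -, H₃, -, hH₃, -, -, hL'H₃, -⟩ :=
    exists_two_hosts_of_mem_edgeLikeSubgroups_of_isGraph h𝒢 hG c b' hL'b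
  -- "precisely two": `H₃` is `H₁` or `H₂`
  obtain ⟨honly, -⟩ := (hCV 𝒢 h𝒢 c (L ⊓ L') hKc).2 hKne u₁ u₂ H₁ H₂ hH₁ hH₂ h12
    (inf_le_left.trans hLH₁) (inf_le_left.trans hLH₂)
  have hCC : Subgroup.Commensurable.commensurator L = Subgroup.Commensurable.commensurator L' := hc.eq
  -- with a common verticial host `H`: `L = C(L) ∩ H = C(L') ∩ H = L'`
  have key : ∀ {w : 𝒢.graph.Vertex} {H : Subgroup c.G}, H ∈ verticialSubgroups c w → L ≤ H → L' ≤ H →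
      L = L' := by
    intro w H hH hLH hL'H
    rw [← commensurator_inf_eq_of_edgeLike_le_verticial hCV h𝒢 hG c hLb hH hLH,
      ← commensurator_inf_eq_of_edgeLike_le_verticial hCV h𝒢 hG c hL'b hH hL'H, hCC]
  rcases honly u₃ H₃ hH₃ (inf_le_right.trans hL'H₃) with rfl | rfl
  · exact key hH₁ hLH₁ hL'H₃
  · exact key hH₂ hLH₂ hL'H₃

/-- **`hrigid` for edge-like subgroups, in the `VN`-binder shape of abc-iut-w4-d059's cores**
(`EN := {L | ∃ e, L ∈ edgeLikeSubgroups c e}`): commensurable members of `EN` are equal — modulo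
`CompactInVerticial`. [cite: MochizukiSemiAnbd2006, Thm 3.7 (iii)(iv), pp. 40–41; §5, p. 65] -/
theorem edgeLike_commensurable_rigid (hCV : CompactInVerticial.{u}) (h𝒢 : 𝒢.Thm37Hypotheses)
    (hG : 𝒢.graph.IsGraph) (c : TemperedPiChart 𝒢) :
    ∀ L ∈ {L : Subgroup c.G | ∃ e : 𝒢.graph.Edge, L ∈ edgeLikeSubgroups c e},
      ∀ L' ∈ {L : Subgroup c.G | ∃ e : 𝒢.graph.Edge, L ∈ edgeLikeSubgroups c e},
        Subgroup.Commensurable L L' → L = L' := by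
  rintro L ⟨e, hL⟩ L' ⟨e', hL'⟩ hc
  exact eq_of_commensurable_of_mem_edgeLikeSubgroups hCV h𝒢 hG c hL hL' hc

end ProfiniteSemiGraph

end Literature.AnabelianGeometry.SemiGraphs
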